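import Literature.Barriers.Schanuel.AlgebraicIndependenceOfLogarithmsThm4FromThm2C
import HarnessLib

/-!
# Barrier (Schanuel): Roy 1992, Theorem 4 PROVED from Theorem 2

Final file of the deduction of Roy's Theorem 4 (the named fact
`Literature.Barriers.Schanuel.roy1992_thm4`) from his Theorem 2 (the named fact
`Literature.Barriers.Schanuel.roy1992_thm2`) [Roy1992, §4 pp. 34–37], on top of the support files
`…RationalLemmas`, `…Thm4FromThm2A/B/C`. With the earlier companions this puts the strong six
exponentials theorem on Roy's Theorem 2 alone:
`roy1992_thm2 → roy1992_thm4 → roy1992_cor1 → roy1992_strongSixExponentials`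
(`roy1992_strongSixExponentials_of_thm2`); below Theorem 2 there remains only Waldschmidt's
Theorem 1 (`roy1992_thm1`, [Waldschmidt1988, Thm 4.1]) and Roy's §§2–3.

## The printed proof (pp. 34–37) and its rendering

"By induction on `d` … If `d' < d`, this allows us … to assume the theorem true for the triple
`(d', Z', U')`. The choice of the application `t` attached to `(d, Z, U)` justifies the right
inequality in (1). Also, it allows us to choose the identity mapping of `K^{d'}` in applying the
theorem to `(d', Z', U')`, and this gives the left inequality in (1) if `d' < d`. This brings us to
proving the theorem in the case `d' = d`. In this case, `t` is an isomorphism … Therefore, `U`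
satisfies (2) … From this, we shall deduce (3) `dim_ℚ̄(Z)/(d + dim_ℚ̄(Z)) ≤ dim_K(U)/d`. It is
clear if `U = K^d`. We thus suppose `U ≠ K^d`" — `Roy1992.thm4_of_thm2` (the induction)
and `Roy1992.core` ((2) ⇒ (3)). For (3): the number field `k`, the basis `η`, the map `φ`,
`W = φ⁻¹(0)`, `V = φ⁻¹(U)` (support files), and "Theorem 2 applies to the family
`(K^d × (K^d)^m, Y, W, V)` … If for `s` the identity mapping of `K^d × (K^d)^m` is chosen,
Theorem 2 gives `(md + dim_ℚ(Y))/(d + md − dim_K(W)) ≤ md/(d + md − dim_K(V))` … Making use of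
(6), we then get `(d + dim_ℚ̄(Z))/d ≤ d/(d − dim_K(U))`, from which the inequality (3) follows"
(p. 37), the legitimacy of the identity being conditions (4) and (5) of file `…C`.

One deviation from the letter of p. 35: Roy takes `Y = φ⁻¹(Z₁) ∩ (k^d × (L^d)^m)`; we take for `Y`
the `ℚ`-span of chosen `φ`-preimages in `k^d × (L^d)^m` of the `mn` vectors `η_μ z_r` (`z_r` a
`ℚ̄`-basis of `Z`), which has all the properties the argument uses (`Y ⊆ ℚ̄^{d₀} × L^{d₁}`,
`φ(Y) ⊆ U`, finite-dimensional, `dim_ℚ Y ≥ m dim_ℚ̄ Z`) and whose finite-dimensionality does not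
require Baker's theorem.

## References

* [Roy1992] D. Roy, *Matrices whose coefficients are linear forms in logarithms*, J. Number
  Theory 41 (1992) 22–47: §4, Theorem 4 and its proof, pp. 34–37.
* [Waldschmidt1988] M. Waldschmidt, *On the transcendence methods of Gel'fond and Schneider in
  several variables*, New Advances in Transcendence Theory (1988), Thm 4.1.
-/

noncomputable section

open Module Submodule Complex

namespace Literature.Barriers.Schanuel.Roy1992

variable {d : ℕ}

/-! ### Small lemmas -/

/-- Composition of maps rational over `ℚ̄` is rational over `ℚ̄`. [folklore] -/
theorem isRationalMap_comp {d₁ d₂ d₃ : ℕ} {t : (Fin d₁ → ℂ) →ₗ[ℂ] (Fin d₂ → ℂ)}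
    {t' : (Fin d₂ → ℂ) →ₗ[ℂ] (Fin d₃ → ℂ)} (ht : IsRationalMap t) (ht' : IsRationalMap t') :
    IsRationalMap (t' ∘ₗ t) :=
  fun v hv j => ht' _ (ht v hv) j

/-- The identity of `K^d`, `d > 0`, is non-zero. [folklore] -/
theorem id_ne_zero (hd : 0 < d) : (LinearMap.id : (Fin d → ℂ) →ₗ[ℂ] (Fin d → ℂ)) ≠ 0 :=
  ne_zero_of_surjective hd Function.surjective_id

/-- A map given by a matrix over `ℚ̄` maps `𝓛̃^d` into `𝓛̃^{d'}`. [folklore] -/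
theorem mulVecLin_mem_logLinearForms {d' : ℕ} (A : Matrix (Fin d') (Fin d) (algebraicClosure ℚ ℂ)) {z : Fin d → ℂ}
    (hz : ∀ i, z i ∈ logLinearForms) (j : Fin d') :
    (A.map (algebraMap (algebraicClosure ℚ ℂ) ℂ)).mulVecLin z j ∈ logLinearForms := by
  rw [Matrix.mulVecLin_apply, Matrix.mulVec, dotProduct]
  refine sum_mem fun i _ => ?_
  have h : algebraMap (algebraicClosure ℚ ℂ) ℂ (A j i) * z i = (A j i) • z i := by
    rw [IntermediateField.smul_def, smul_eq_mul]; rfl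
  rw [Matrix.map_apply, h]
  exact Submodule.smul_mem _ _ (hz i)

/-! ### (2) ⇒ (3): the heart of the case `d' = d` -/

section Core

variable {m : ℕ} {k : IntermediateField ℚ ℂ} (η : Basis (Fin m) ℚ k) [FiniteDimensional ℚ k]

/-- The `ℚ`-subspace `k^d × 𝓛^{md}` of `K^d × K^{md}` (`𝓛 = logQSpan`), which contains the chosen
preimages and is contained in `ℚ̄^{d₀} × L^{d₁}`. [cite: Roy1992, §4 proof of Theorem 4 (p. 35)] -/
def goodSubspace (d m : ℕ) (k : IntermediateField ℚ ℂ) : Submodule ℚ (LinTangent d (m * d)) :=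
  (Submodule.pi Set.univ fun _ : Fin d => (Subalgebra.toSubmodule k.toSubalgebra : Submodule ℚ ℂ)).prod
    (Submodule.pi Set.univ fun _ : Fin (m * d) => logQSpan)

omit [FiniteDimensional ℚ k] in
/-- Membership in `goodSubspace`. [folklore] -/
theorem mem_goodSubspace {p : LinTangent d (m * d)} :
    p ∈ goodSubspace d m k ↔ (∀ i, p.1 i ∈ k) ∧ ∀ j, p.2 j ∈ logQSpan := by
  simp [goodSubspace, Submodule.mem_prod, Submodule.mem_pi]

/-- A `ℚ`-subspace of `k^d × 𝓛^{md}` is contained in `ℚ̄^{d₀} × L^{d₁}`. [folklore] -/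
theorem isQbarLogSubspace_of_le {Y : Submodule ℚ (LinTangent d (m * d))}
    (hY : Y ≤ goodSubspace d m k) : IsQbarLogSubspace Y := by
  intro y hy
  obtain ⟨h1, h2⟩ := (mem_goodSubspace (k := k)).1 (hY hy)
  exact ⟨fun i => mem_algebraicClosure_of_mem_numberField (h1 i),
    fun j => isAlgebraic_cexp_of_mem_logQSpan (h2 j)⟩

/-- **Roy's (2) ⇒ (3)** (the case `d' = d` of Theorem 4, given Theorem 2): if `U ⊆ K^d` (`d > 0`)
contains the finite-dimensional `ℚ̄`-subspace `Z ⊆ 𝓛̃^d` and satisfies the minimality (2), then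
`dim_ℚ̄(Z)/(d + dim_ℚ̄(Z)) ≤ dim_K(U)/d` (3). Proof as on pp. 35–37, applying `roy1992_thm2` to
`(K^d × (K^d)^m, Y, W = ker φ, V = φ⁻¹(U))` with the identity, legitimate by (4)
(`fPoints_eq_bot_of_minimal`) and (5) (`thm2Ratio_id_le`).
[cite: Roy1992, §4 proof of Theorem 4, (2)–(3) and pp. 35–37] -/
theorem core (h2 : roy1992_thm2) (hd : 0 < d) (Z : Submodule (algebraicClosure ℚ ℂ) (Fin d → ℂ))
    (U : Submodule ℂ (Fin d → ℂ)) [Module.Finite (algebraicClosure ℚ ℂ) Z]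
    (hZ : ∀ z ∈ Z, ∀ i, z i ∈ logLinearForms) (hZU : Z ≤ U.restrictScalars (algebraicClosure ℚ ℂ))
    (hmin : IsMinimalTwo d U) :
    (finrank (algebraicClosure ℚ ℂ) Z : ℝ) / (d + finrank (algebraicClosure ℚ ℂ) Z) ≤ (finrank ℂ U : ℝ) / d := by
  have hdR : (0 : ℝ) < d := by exact_mod_cast hd
  have hn0 : (0 : ℝ) ≤ finrank (algebraicClosure ℚ ℂ) Z := by positivity
  by_cases hU : U = ⊤
  · rw [hU, finrank_top, finrank_fin_fun, div_self hdR.ne']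
    rw [div_le_one (by linarith)]
    linarith
  -- the number field, its basis, the vectors `η_μ z_r` and their `φ`-preimages
  obtain ⟨k, hk, b₀, hb₀⟩ := exists_numberField_basis Z hZ
  haveI := hk
  -- opaque dimensions `m = [k : ℚ]`, `n = dim_ℚ̄ Z` (keeps `finrank` out of the types)
  obtain ⟨m, η, hmk⟩ : ∃ (m : ℕ) (η : Basis (Fin m) ℚ k), finrank ℚ k = m :=
    ⟨finrank ℚ k, Module.finBasis ℚ k, rfl⟩
  obtain ⟨n, b, hb, hnZ⟩ : ∃ (n : ℕ) (b : Basis (Fin n) (algebraicClosure ℚ ℂ) Z),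
      (∀ r i, (b r : Fin d → ℂ) i ∈ Submodule.span k ({1} ∪ {x : ℂ | IsAlgebraic ℚ (cexp x)})) ∧
      finrank (algebraicClosure ℚ ℂ) Z = n := ⟨_, b₀, hb₀, rfl⟩
  have hz : LinearIndependent (algebraicClosure ℚ ℂ) (fun r => (b r : Fin d → ℂ)) :=
    b.linearIndependent.map' Z.subtype Z.ker_subtype
  have hpre : ∀ p : Fin m × Fin n, ∃ q : LinTangent d (m * d),
      phi η q = ((η p.1 : k) : ℂ) • (b p.2 : Fin d → ℂ) ∧ (∀ i, q.1 i ∈ k) ∧ ∀ j, q.2 j ∈ logQSpan :=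
    fun p => exists_phi_preimage η fun i => by
      have h : (((η p.1 : k) : ℂ) • (b p.2 : Fin d → ℂ)) i = (η p.1 : k) • ((b p.2 : Fin d → ℂ) i) := by
        rw [Pi.smul_apply, IntermediateField.smul_def]
      rw [h]
      exact Submodule.smul_mem _ _ (hb p.2 i)
  choose q hq hq1 hq2 using hpre
  set Y : Submodule ℚ (LinTangent d (m * d)) := Submodule.span ℚ (Set.range q) with hYdef
  have hYli : LinearIndependent ℚ q := by
    refine LinearIndependent.of_comp ((phi η).restrictScalars ℚ) ?_
    have hcomp : ⇑((phi η).restrictScalars ℚ) ∘ q =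
        fun p => ((η p.1 : k) : ℂ) • (b p.2 : Fin d → ℂ) := funext hq
    rw [hcomp]
    exact linearIndependent_eta_smul (z := fun r => (b r : Fin d → ℂ)) η hz
  have hYfin : FiniteDimensional ℚ Y := FiniteDimensional.span_of_finite ℚ (Set.finite_range q)
  have hYrank : finrank ℚ Y = m * n := by
    rw [hYdef, finrank_span_eq_card hYli, Fintype.card_prod, Fintype.card_fin, Fintype.card_fin]
  have hYgood : Y ≤ goodSubspace d m k := by
    rw [hYdef, Submodule.span_le]
    rintro _ ⟨p, rfl⟩
    exact (mem_goodSubspace (k := k)).2 ⟨hq1 p, hq2 p⟩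
  have hYlog : IsQbarLogSubspace Y := isQbarLogSubspace_of_le hYgood
  -- `W = ker φ`, `V = φ⁻¹(U)`
  have hW : IsQbarRational (LinearMap.ker (phi (d := d) η)) := isQbarRational_ker_phi (d := d) η
  set V : Submodule ℂ (LinTangent d (m * d)) := U.comap (phi η) with hVdef
  have hYV : Y ≤ V.restrictScalars ℚ := by
    rw [hYdef, Submodule.span_le]
    rintro _ ⟨p, rfl⟩
    rw [SetLike.mem_coe, Submodule.restrictScalars_mem, hVdef, Submodule.mem_comap, hq]
    exact U.smul_mem _ (hZU (b p.2).2)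
  have hWV : LinearMap.ker (phi η) ≤ V := by
    rw [hVdef, ← Submodule.comap_bot]
    exact Submodule.comap_mono bot_le
  have hV : V ≠ ⊤ := by
    intro h
    apply hU
    rw [← Submodule.map_comap_eq_of_surjective (phi_surjective η) U, ← hVdef, h, Submodule.map_top,
      LinearMap.range_eq_top.2 (phi_surjective η)]
  -- Theorem 2, with the identity
  obtain ⟨-, hall⟩ := h2 d (m * d) Y (LinearMap.ker (phi η)) V hYfin hYlog hW hYV hWV hV
  have hminId : IsThm2Minimal V d (m * d) LinearMap.id :=
    ⟨isAdmissible_id _ _, by rwa [Submodule.map_id],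
      fun d₀' d₁' s hs hsV => thm2Ratio_id_le η hd hU hmin s hs hsV⟩
  have h4 : ∀ v ∈ V.map LinearMap.id, (∀ i, v.1 i ∈ (algebraicClosure ℚ ℂ)) → v.2 = 0 → v = 0 := by
    intro v hv hv1 hv2
    rw [Submodule.map_id, hVdef, Submodule.mem_comap, phi_apply, hv2, map_zero, add_zero] at hv
    let v₀ : Fin d → (algebraicClosure ℚ ℂ) := fun i => ⟨v.1 i, hv1 i⟩
    have hv₀ : incl (algebraicClosure ℚ ℂ) ℂ d v₀ = v.1 := funext fun i => rfl
    have hmem : v₀ ∈ fPoints (F := (algebraicClosure ℚ ℂ)) U := by rw [mem_fPoints, hv₀]; exact hv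
    rw [fPoints_eq_bot_of_minimal hd hU hmin, Submodule.mem_bot] at hmem
    refine Prod.ext ?_ hv2
    rw [← hv₀, hmem, map_zero]
    rfl
  obtain ⟨hineq, -⟩ := hall d (m * d) LinearMap.id hminId h4
  -- read off the numbers
  have hidQ : ((LinearMap.id : LinTangent d (m * d) →ₗ[ℂ] _).restrictScalars ℚ) = LinearMap.id := rfl
  have hVfin : finrank ℂ V = finrank ℂ U + m * d := by
    rw [hVdef, finrank_comap_of_surjective _ (phi_surjective η), finrank_ker_phi]
  have hu : finrank ℂ U < d := by
    have := Submodule.finrank_lt hU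
    simpa using this
  set u := finrank ℂ U with hudef
  have hmpos : 0 < m := hmk ▸ finrank_pos
  rw [hidQ, Submodule.map_id, Submodule.map_id, hYrank, finrank_ker_phi, thm2Ratio, Submodule.map_id,
    hVfin] at hineq
  rw [hnZ]
  have huR : (u : ℝ) < d := by exact_mod_cast hu
  have hmR : (0 : ℝ) < m := by exact_mod_cast hmpos
  have hineq' : (((m * d : ℕ) : ℝ) + ((m * n : ℕ) : ℝ)) / d ≤ ((m * d : ℕ) : ℝ) / (d - u) := by
    have e1 : (d : ℝ) + ((m * d : ℕ) : ℝ) - ((m * d : ℕ) : ℝ) = d := by ring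
    have e2 : (d : ℝ) + ((m * d : ℕ) : ℝ) - ((u + m * d : ℕ) : ℝ) = d - u := by push_cast; ring
    rw [e1, e2] at hineq
    exact hineq
  rw [div_le_div_iff₀ hdR (by linarith)] at hineq'
  rw [div_le_div_iff₀ (by linarith) hdR]
  push_cast at hineq'
  nlinarith [mul_pos hmR hdR, hineq']

end Core

/-! ### The induction on `d` -/

/-- **Theorem 4 from Theorem 2** (in Roy's namespace; the induction on `d` of p. 34 around
`Roy1992.core`). [cite: Roy1992, §4 Theorem 4 and its proof (pp. 34–37)] -/
theorem thm4_of_thm2 (h2 : roy1992_thm2) : roy1992_thm4 := by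
  intro d
  induction d using Nat.strong_induction_on with
  | _ d ih =>
  intro hd Z U hZfin hZ hZU d' t ht hrat hne hmin
  haveI := hZfin
  -- the right inequality: minimality against the identity
  have hR : (finrank ℂ (U.map t) : ℝ) / d' ≤ (finrank ℂ U : ℝ) / d := by
    have := hmin d LinearMap.id Function.surjective_id (isRationalMap_id d) (id_ne_zero hd)
    rwa [Submodule.map_id] at this
  refine ⟨?_, hR⟩
  have hd'le : d' ≤ d := by simpa using LinearMap.finrank_le_finrank_of_surjective ht
  have hd'pos : 0 < d' := by
    rcases Nat.eq_zero_or_pos d' with h0 | h0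
    · subst h0
      exact absurd (LinearMap.ext fun v => Subsingleton.elim _ _) hne
    · exact h0
  rcases hd'le.lt_or_eq with hlt | heq
  · -- `d' < d`: the induction hypothesis for `(d', Z', U')` and the identity
    obtain ⟨A, rfl⟩ := exists_eq_mulVecLin_of_isRationalMap hrat
    have hZ' : ∀ z ∈ Z.map (((A.map (algebraMap (algebraicClosure ℚ ℂ) ℂ)).mulVecLin).restrictScalars (algebraicClosure ℚ ℂ)), ∀ i,
        z i ∈ logLinearForms := by
      rintro _ ⟨z, hz, rfl⟩ i
      exact mulVecLin_mem_logLinearForms A (hZ z hz) i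
    have hZ'U' : Z.map (((A.map (algebraMap (algebraicClosure ℚ ℂ) ℂ)).mulVecLin).restrictScalars (algebraicClosure ℚ ℂ)) ≤
        (U.map (A.map (algebraMap (algebraicClosure ℚ ℂ) ℂ)).mulVecLin).restrictScalars (algebraicClosure ℚ ℂ) := by
      rintro _ ⟨z, hz, rfl⟩
      exact Submodule.mem_map_of_mem (hZU hz)
    have hmin' : ∀ (d'' : ℕ) (t'' : (Fin d' → ℂ) →ₗ[ℂ] (Fin d'' → ℂ)), Function.Surjective t'' →
        IsRationalMap t'' → t'' ≠ 0 →
        (finrank ℂ ((U.map (A.map (algebraMap (algebraicClosure ℚ ℂ) ℂ)).mulVecLin).map LinearMap.id) : ℝ) / d' ≤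
          (finrank ℂ ((U.map (A.map (algebraMap (algebraicClosure ℚ ℂ) ℂ)).mulVecLin).map t'') : ℝ) / d'' := by
      intro d'' t'' ht'' hrat'' hne''
      rw [Submodule.map_id, ← Submodule.map_comp]
      refine hmin d'' (t'' ∘ₗ (A.map (algebraMap (algebraicClosure ℚ ℂ) ℂ)).mulVecLin) (ht''.comp ht)
        (isRationalMap_comp hrat hrat'') ?_
      intro h0
      apply hne''
      refine LinearMap.ext fun w => ?_
      obtain ⟨v, rfl⟩ := ht w
      exact congrArg (fun f => f v) (congrArg DFunLike.coe h0)
    have hIH := (ih d' hlt hd'pos _ _ inferInstance hZ' hZ'U' d' LinearMap.id Function.surjective_id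
      (isRationalMap_id d') (id_ne_zero hd'pos) hmin').1
    have hidQ : ((LinearMap.id : (Fin d' → ℂ) →ₗ[ℂ] (Fin d' → ℂ)).restrictScalars (algebraicClosure ℚ ℂ)) =
        LinearMap.id := rfl
    rwa [hidQ, Submodule.map_id, Submodule.map_id] at hIH
  · -- `d' = d`: `t` is an isomorphism and `U` satisfies (2)
    subst heq
    have htinj : Function.Injective t := LinearMap.injective_iff_surjective.2 ht
    have hUt : finrank ℂ (U.map t) = finrank ℂ U :=
      (LinearEquiv.finrank_eq (Submodule.equivMapOfInjective t htinj U)).symm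
    have hZt : finrank (algebraicClosure ℚ ℂ) (Z.map (t.restrictScalars (algebraicClosure ℚ ℂ))) = finrank (algebraicClosure ℚ ℂ) Z :=
      (LinearEquiv.finrank_eq (Submodule.equivMapOfInjective (t.restrictScalars (algebraicClosure ℚ ℂ)) htinj Z)).symm
    rw [hUt, hZt]
    refine core h2 hd Z U hZ hZU fun d₁ t₁ ht₁ hrat₁ hne₁ => ?_
    have := hmin d₁ t₁ ht₁ hrat₁ hne₁
    rwa [hUt] at this

/-! ### The results -/

end Literature.Barriers.Schanuel.Roy1992

namespace Literature.Barriers.Schanuel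

/-- **Roy 1992, Theorem 4 PROVED from Theorem 2** (`roy1992_thm2 → roy1992_thm4`), following the
printed proof (pp. 34–37): induction on `d`; in the case `d' = d`, Theorem 2 applied to
`(K^d × (K^d)^m, Y, W, V)` with the identity. [cite: Roy1992, §4 Theorem 4 and its proof (pp. 34–37)] -/
theorem roy1992_thm4_of_thm2 (h2 : roy1992_thm2) : roy1992_thm4 :=
  Roy1992.thm4_of_thm2 h2

/-- **The strong six exponentials theorem from Roy's Theorem 2** (PROVED reduction
`roy1992_thm2 → roy1992_strongSixExponentials`, composing with `roy1992_strongSixExponentials_of_thm4`):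
below it remain only Waldschmidt's Theorem 1 and Roy's §§2–3.
[cite: Roy1992, §4 Corollary 2 (p. 38)] -/
theorem roy1992_strongSixExponentials_of_thm2 (h2 : roy1992_thm2) : roy1992_strongSixExponentials :=
  roy1992_strongSixExponentials_of_thm4 (roy1992_thm4_of_thm2 h2)

end Literature.Barriers.Schanuel
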